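import Literature.Computability.Cryptography.LWEPrimePowerProgEst
import Literature.Computability.Cryptography.LWEPrimePowerProgIndex
import HarnessLib

/-!
# The Micciancio–Peikert machine, III′: the list-level estimation query IS the solver's estimation query

Topic `Computability/Cryptography` (LWE), grouping namespace `LWE.MP12.Prog`, bridge between
`LWEPrimePowerProgEst.lean` (`estQueryL`, the estimation query assembled on lists) and the solver side
(`LWEPrimePowerSolverData.estBlock` on the structured input `LWEPrimePowerLayout.layout (S, coins)`).
Proved material (no named fact) towards
`Literature.Computability.Cryptography.blprs_gapSVP_sqrt_dim_to_lwe_classical` (**pqc.S21**),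
hypothesis `h₂`: on a genuine input — the samples `S`, a coin string `r` of length `≥ numCoins` (its
first `numCoins` bits being the coins of the layout), the parameter tuple `(d, e, 2ᵉ, m, K'+1, …, ℓ)` —
**`estQueryL_eq`**: the list-level estimation query of unit `(j, k)` is the list form `toLData` of
`estBlock K' m j` of the layout's unit, paired with the list of the unit's coin slice. (So the string
the machine writes IS the tagged code of the query the analysis speaks of, `ldataE_toLData`.)

## References

* D. Micciancio, C. Peikert, *Trapdoors for lattices: simpler, tighter, faster, smaller*, EUROCRYPT 2012,
  LNCS 7237; full version IACR ePrint 2011/501, §3, Thm. 3.1 proof (p. 15). [MicciancioPeikert2012]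
-/

noncomputable section

namespace Literature.Computability.Cryptography

namespace LWE

namespace MP12

namespace Prog

open _root_.Computability Literature.Computability.Complexity Finset

/-! ### List helpers -/

section ListHelpers

variable {α β γ : Type}

/-- A map over `List.range` as `List.ofFn`. [folklore] -/
theorem map_range_eq_ofFn (d : ℕ) (g : ℕ → β) : (List.range d).map g = List.ofFn fun i : Fin d => g i.val := by
  apply List.ext_getElem <;> simp

/-- `zipWith` of two `List.ofFn`. [folklore] -/
theorem zipWith_ofFn {n : ℕ} (f : α → β → γ) (u : Fin n → α) (v : Fin n → β) :
    List.zipWith f (List.ofFn u) (List.ofFn v) = List.ofFn fun i => f (u i) (v i) := by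
  apply List.ext_getElem <;> simp

/-- `getD` of `List.ofFn` inside the range. [folklore] -/
theorem getD_ofFn {n : ℕ} (f : Fin n → α) (dflt : α) (i : Fin n) : (List.ofFn f).getD i.val dflt = f i := by
  rw [List.getD_eq_getElem _ _ (by simp)]
  simp

end ListHelpers

/-! ### The bridge -/

section Bridge

variable (d e K' m N T N' m' ℓ G : ℕ)

/-- The parameter tuple of the genuine input. [folklore] -/
def Pof : PrmT := (d, (e, (2 ^ e, (m, (K' + 1, (G, (T, (N, (N', (m', ℓ))))))))))

/-- `numScalarsL` of the tuple is `numScalars`. [folklore] -/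
theorem numScalarsL_Pof : numScalarsL (Pof d e K' m N T N' m' ℓ G) = numScalars d e m N T N' := rfl

variable (S : Fin (numSamples d e K' m N T N' m') → (Fin d → ZMod (2 ^ e)) × ZMod (2 ^ e)) (r : List Bool)

/-- The coins of the layout: the first `numCoins` bits of the coin string. [cite: AroraBarak2009, Def. 7.1] -/
def coinsOf : Fin (numCoins d e m N T N' ℓ) → Bool := fun i => r.getD i.val false

variable {d e K' m N T N' m' ℓ G S r}

/-- **A list-level scalar is the layout's uniform scalar** (as a residue), when the coin string is long
enough. [cite: AroraBarak2009, Def. 7.1] -/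
theorem cast_scalarAt (hr : numCoins d e m N T N' ℓ ≤ r.length) (i : Fin (numScalars d e m N T N')) :
    ((scalarAt r e i.val : ℕ) : ZMod (2 ^ e)) = scalarsOf d e m N T N' (split2 _ _ (coinsOf d e m N T N' ℓ r)).1 i := by
  rw [scalarsOf_eq, chunkVal_eq_bitsToNat, scalarAt, strSliceAt_eq, sliceAt_eq_ofFn_getD r (i.val * e) e false]
  · rfl
  · calc i.val * e + e = (i.val + 1) * e := by ring
      _ ≤ numScalars d e m N T N' * e := Nat.mul_le_mul_right e i.2
      _ ≤ numCoins d e m N T N' ℓ := Nat.le_add_right _ _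
      _ ≤ r.length := hr

/-- **The list-level estimation query is the solver's estimation query** on the layout of `(S, coins)`.
[cite: MicciancioPeikert2012, Thm. 3.1 proof (p. 15)] -/
theorem estQueryL_eq (hr : numCoins d e m N T N' ℓ ≤ r.length) (j : Fin (e + 1)) (k : Fin N') :
    estQueryL (Pof d e K' m N T N' m' ℓ G) d (K' + 1) e (List.ofFn fun i => toItem (S i)) r j.val k.val =
      (toLData (estBlock K' m j.val ((layout d e K' m N T N' m' ℓ (S, coinsOf d e m N T N' ℓ r)).1 j k).1),
        List.ofFn ((layout d e K' m N T N' m' ℓ (S, coinsOf d e m N T N' ℓ r)).1 j k).2) := by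
  haveI : NeZero (2 ^ e) := ⟨(Nat.two_pow_pos e).ne'⟩
  have hQ1 : 1 ≤ 2 ^ e := Nat.two_pow_pos e
  set u := (layout d e K' m N T N' m' ℓ (S, coinsOf d e m N T N' ℓ r)).1 j k with hu
  obtain ⟨jk, hjk⟩ : ∃ jk : ℕ, jk = j.val * N' + k.val := ⟨_, rfl⟩
  have hjk_lt : jk < (e + 1) * N' := by
    have := idx₂_lt j k (⟨0, Nat.one_pos⟩ : Fin 1)
    simp at this
    omega
  -- the raw samples of the unit, by item and position
  set zs2 : Fin m → Fin (K' + 1) → (Fin d → ZMod (2 ^ e)) × ZMod (2 ^ e) :=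
    fun i q => S ⟨jk * (m * (K' + 1)) + (i.val * (K' + 1) + q.val), by
      have := idx₂_lt (⟨0, Nat.one_pos⟩ : Fin 1) i q
      simp at this
      have h1 : (jk + 1) * (m * (K' + 1)) ≤ nEs e K' m N' := by
        unfold nEs
        calc (jk + 1) * (m * (K' + 1)) ≤ ((e + 1) * N') * (m * (K' + 1)) := Nat.mul_le_mul_right _ hjk_lt
          _ = (e + 1) * (N' * (m * (K' + 1))) := by ring
      have h2 : nEs e K' m N' ≤ numSamples d e K' m N T N' m' := Nat.le_add_right _ _
      have h3 : (jk + 1) * (m * (K' + 1)) = jk * (m * (K' + 1)) + m * (K' + 1) := by ring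
      omega⟩ with hzs2
  -- the pieces of the tuple
  simp only [estQueryL, Pof, PrmT.d, PrmT.Q, PrmT.N', toLData]
  simp only [← hjk]
  refine Prod.ext (Prod.ext rfl (Prod.ext rfl ?_)) ?_
  · -- the block: the groups of raw samples of the unit
    have hsl : jk * (m * (K' + 1)) + m * (K' + 1) ≤ numSamples d e K' m N T N' m' := by
      calc jk * (m * (K' + 1)) + m * (K' + 1) = (jk + 1) * (m * (K' + 1)) := by ring
        _ ≤ ((e + 1) * N') * (m * (K' + 1)) := Nat.mul_le_mul_right _ hjk_lt
        _ = nEs e K' m N' := by unfold nEs; ring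
        _ ≤ numSamples d e K' m N T N' m' := Nat.le_add_right _ _
    have hgrp : estGroups (d, e, 2 ^ e, m, K' + 1, G, T, N, N', m', ℓ) (K' + 1) (List.ofFn fun i => toItem (S i)) jk =
        List.ofFn fun i : Fin m => List.ofFn fun q : Fin (K' + 1) => toItem (zs2 i q) := by
      unfold estGroups
      simp only [PrmT.m, PrmT.K]
      rw [sliceAt_ofFn _ _ _ hsl, chunks_ofFn (Nat.succ_pos K')]
    rw [hgrp, mapIdx_ofFn, List.map_ofFn]
    show List.ofFn _ = List.ofFn _
    congr 1
    funext i
    -- per item: notation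
    set zs : Fin (K' + 1) → (Fin d → ZMod (2 ^ e)) × ZMod (2 ^ e) := zs2 i with hzs
    have hzs_eq : ∀ q, (u.1.1 i).1 q = zs q := by
      intro q
      rw [hu, layout_est_smp, hzs, hzs2]
      congr 1
      exact Fin.ext (by simp [hjk]; ring)
    have hidx : jk * m + i.val < numScalars d e m N T N' :=
      lt_of_lt_of_le (by rw [hjk]; exact idx₂_lt j k i) (Nat.le_add_right _ _)
    have hlvl : (u.1.1 i).2 = ((scalarAt r e (jk * m + i.val) : ℕ) : ZMod (2 ^ e)) := by
      rw [hu, layout_est_lvl, cast_scalarAt hr ⟨jk * m + i.val, hidx⟩]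
      congr 1
      exact Fin.ext (by simp only [hjk])
    have hidx' : ∀ cc : Fin d, rEl e m N' + jk * d + cc.val < numScalars d e m N T N' := fun cc =>
      lt_of_lt_of_le (by rw [hjk, Nat.add_assoc]; exact Nat.add_lt_add_left (idx₂_lt j k cc) _)
        (by unfold numScalars rEs; omega)
    have hτ : ∀ cc : Fin d, u.1.2 cc = ((scalarAt r e (rEl e m N' + jk * d + cc.val) : ℕ) : ZMod (2 ^ e)) := by
      intro cc
      rw [hu, layout_est_shift, cast_scalarAt hr ⟨rEl e m N' + jk * d + cc.val, hidx' cc⟩]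
      congr 1
      exact Fin.ext (by simp only [hjk, Nat.add_assoc])
    have hgen : genAt (d, e, 2 ^ e, m, K' + 1, G, T, N, N', m', ℓ) e j.val = (gen 2 e j.val).val := by
      simp only [genAt, PrmT.e, PrmT.Q, Nat.min_eq_left (Nat.sub_le e j.val), Nat.max_eq_left hQ1, gen]
      rw [show ((2 : ℕ) : ZMod (2 ^ e)) = 2 from rfl, val_two_pow]
    -- the solver's item
    have hsum : sumSamples (u.1.1 i).1 = ∑ q, zs q := by
      unfold sumSamples
      exact Finset.sum_congr rfl fun q _ => hzs_eq q
    conv_rhs => rw [estBlock]; simp only [Function.comp_apply, item, hybridize, hsum, shiftSample, toItem]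
    -- the list-level item
    simp only [Function.comp_apply, estItemL, shiftItem, addB, aggItem, PrmT.Q, PrmT.e, PrmT.m, Nat.max_eq_left hQ1]
    have hget : ∀ (cc : Fin d) (q : Fin (K' + 1)), (toItem (zs q)).1.getD cc.val 0 = ((zs q).1 cc).val := fun cc q => by
      rw [toItem]
      exact getD_ofFn _ _ cc
    -- (i) the `a`-list
    have ha : (List.range d).map (fun cc => sumMod (2 ^ e) ((List.ofFn fun q => toItem (zs q)).map fun x => x.1.getD cc 0)) =
        List.ofFn fun cc : Fin d => ((∑ q, zs q).1 cc).val := by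
      rw [map_range_eq_ofFn]
      congr 1
      funext cc
      rw [List.map_ofFn, sumMod_eq hQ1, List.sum_ofFn, Prod.fst_sum, Finset.sum_apply, val_sum]
      congr 1
      exact Finset.sum_congr rfl fun q _ => hget cc q
    rw [ha]
    refine Prod.ext rfl ?_
    -- (ii) the `b`-value, through the residues
    simp only
    have hb0 : ((sumMod (2 ^ e) ((List.ofFn fun q => toItem (zs q)).map Prod.snd) : ℕ) : ZMod (2 ^ e)) = (∑ q, zs q).2 := by
      rw [List.map_ofFn, sumMod_eq hQ1, List.sum_ofFn, ZMod.natCast_mod, Nat.cast_sum, Prod.snd_sum]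
      exact Finset.sum_congr rfl fun q _ => by simp [toItem]
    have hdot : ((dotMod (2 ^ e) (List.ofFn fun cc : Fin d => ((∑ q, zs q).1 cc).val)
        (estTauL (d, e, 2 ^ e, m, K' + 1, G, T, N, N', m', ℓ) d r jk) : ℕ) : ZMod (2 ^ e)) = (∑ q, zs q).1 ⬝ᵥ u.1.2 := by
      rw [estTauL]
      simp only [PrmT.e, PrmT.N', PrmT.m, PrmT.d]
      rw [map_range_eq_ofFn, dotMod_eq hQ1, zipWith_ofFn, List.sum_ofFn, ZMod.natCast_mod, Nat.cast_sum, dotProduct]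
      refine Finset.sum_congr rfl fun cc _ => ?_
      rw [Nat.cast_mul, ZMod.natCast_zmod_val, hτ cc]
    -- compare through the residues: both sides are `< 2ᵉ` and cast to the same residue
    have hcast : ∀ a : ℕ, a % 2 ^ e = (((a % 2 ^ e : ℕ) : ZMod (2 ^ e))).val := fun a => by
      rw [ZMod.val_natCast, Nat.mod_mod]
    rw [hcast]
    congr 1
    rw [ZMod.natCast_mod, Nat.cast_add, ZMod.natCast_mod, Nat.cast_add, Nat.cast_mul, hb0, hdot, hgen, ZMod.natCast_zmod_val,
      ← hlvl]
  · -- the coin slice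
    show estCsL _ r jk = List.ofFn u.2
    rw [estCsL, show numScalarsL (d, e, 2 ^ e, m, K' + 1, G, T, N, N', m', ℓ) = numScalars d e m N T N' from rfl, strSliceAt_eq]
    simp only [PrmT.e, PrmT.ℓ]
    rw [sliceAt_eq_ofFn_getD r _ ℓ false]
    · congr 1
      funext t
      rw [hu, layout_est_coin]
      simp [coinsOf, Nat.add_assoc, hjk]
    · calc numScalars d e m N T N' * e + jk * ℓ + ℓ = numScalars d e m N T N' * e + (jk + 1) * ℓ := by ring
        _ ≤ numScalars d e m N T N' * e + ((e + 1) * N') * ℓ := by gcongr; omega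
        _ ≤ numCoins d e m N T N' ℓ := by
            unfold numCoins numCallBits cE
            have : (e + 1) * N' * ℓ = (e + 1) * (N' * ℓ) := by ring
            omega
        _ ≤ r.length := hr

end Bridge

end Prog

end MP12

end LWE

end Literature.Computability.Cryptography

end
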